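import Summits.ValiantsHypothesis.ValiantsHypothesis.Theses.DecompCycle1
import Literature.Computability.AlgebraicComplexity.RazElusiveGeneralRouteProofs

/-!
# `DecompCycle1.TamePerGlue` — the glue of the split of `TamePer` (lens 6 gen 2, MultilinearLift)

`TamePerGlue : PerNotSmVP → TameOrSmLift → TamePer` (item stmt-ValiantsHypothesis-23663): by cases on
the lifting disjunction of `TameOrSmLift` under the collapse `VP_ℂ = VNP_ℂ`, which a tame-or-not
p-bounded real circuit family for `per` yields by extension of scalars
(`ArithCircuit.complexity_map_le`, `map_perPoly`, `isPComputable_perPoly_complex_iff`); the tame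
branch is `TamePer`'s consequent verbatim and the syntactically-multilinear branch is literally the
negation of `PerNotSmVP`. [folklore]
-/

namespace Summit.ValiantsHypothesis.ValiantsHypothesis.Theorems.DecompCycle1TamePerSplit

open Summit.ValiantsHypothesis.ValiantsHypothesis.Theses.DecompCycle1
open Literature.Computability.AlgebraicComplexity

/-- Extension of scalars: a p-bounded circuit family for `per` over `ℝ` is one over `ℂ`.
[cite: Burgisser2000, §4.1] -/
theorem isPComputable_perPoly_complex_of_real'
    (h : IsPComputable (fun n => perPoly (Fin n) ℝ)) : IsPComputable (fun n => perPoly (Fin n) ℂ) := by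
  obtain ⟨c, hc⟩ := h
  refine ⟨c, fun n => le_trans ?_ (hc n)⟩
  have hmap := ArithCircuit.complexity_map_le (algebraMap ℝ ℂ) (perPoly (Fin n) ℝ)
  rwa [map_perPoly] at hmap

/-- The split glue `PerNotSmVP → TameOrSmLift → TamePer`. [folklore] -/
theorem tamePer_of_split (hM : PerNotSmVP) (hB : TameOrSmLift) : TamePer := by
  intro hR
  have heq : VP ℂ = VNP ℂ :=
    isPComputable_perPoly_complex_iff.mp (isPComputable_perPoly_complex_of_real' hR)
  rcases hB heq with hT | ⟨c, hc⟩
  · exact hT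
  · exfalso
    obtain ⟨n, hn⟩ := hM c
    obtain ⟨P, hP2, hPsm, hPc, hPs⟩ := hc n
    exact absurd (hn P hP2 hPsm hPc) (not_lt.mpr hPs)

/-- Closes item stmt-ValiantsHypothesis-23663 (`TamePerGlue`). [folklore] -/
theorem tamePerGlue_holds : TamePerGlue := fun hM hB => tamePer_of_split hM hB

end Summit.ValiantsHypothesis.ValiantsHypothesis.Theorems.DecompCycle1TamePerSplit
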